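import Summits.HubbardSuperconductivity.HubbardSuperconductivity.Theses.ChernVortexResponse
import Literature.MathematicalPhysics.QuantumLattice.MagneticHubbardTorusTrivialField
import Literature.Barriers.QuantumFields.NoContinuousLatticeTopologicalCharge

/-!
# Route `ChernVortexResponse` — supports `MagneticTorusWellPosed` and `OneFluxQuantum`

`MagneticTorusWellPosed` (stmt-HubbardSuperconductivity-1194): for `L ≥ 3` and every `U`, the
one-flux-quantum magnetic Hubbard torus inlined in the route (Landau-type gauge `uniformFlux L`:
links in direction `1` carry `exp(2πi x₀/L²)`, links in direction `0` are trivial except on the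
column `x₀ = L - 1` where they carry `exp(-2πi L x₁/L²)`) is Hermitian, commutes with the total
number `N` and with `S^z`, and its fluxless version is `hubbardTorus 2 L 1 U`.

All four clauses are the tree's facts about `magneticHubbardTorus L A 1 U`
(`Literature/MathematicalPhysics/QuantumLattice/MagneticHubbardTorus*.lean`:
`magneticHubbardTorus_isHermitian`, `magneticHubbardTorus_commute_totalNumber`,
`magneticHubbardTorus_commute_spinZ`, `magneticHubbardTorus_one_eq_hubbardTorus`), read through
the unfolding `magneticHubbardTorus_one` at `A = uniformFlux L` resp. `A = 1`.

`OneFluxQuantum` (stmt-HubbardSuperconductivity-8615): for `L ≥ 2`, `0 < 2π/L² < π` and every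
plaquette holonomy of that phase field equals `exp(2πi/L²)` — the tree's
`u1Plaquette_uniformFlux`, transported to the field pinned by its defining equation.

Sources: E. H. Lieb, Phys. Rev. Lett. 73 (1994) 2158, eqs. (1)–(2); F. F. Assaad, Phys. Rev. B 65
(2002) 115104, §III.B; M. Lüscher, Nucl. Phys. B 549 (1999) 295, §3. No new definitions.
-/

-- the mandated namespace `Summit.<Summit>.<Problem>.Theorems` repeats `HubbardSuperconductivity`
-- (single-problem summit, D-0017), which the `dupNamespace` linter flags on every declaration
set_option linter.dupNamespace false

namespace Summit.HubbardSuperconductivity.HubbardSuperconductivity.Theorems.ChernVortexResponse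

open Matrix Literature.MathematicalPhysics.QuantumLattice
open Literature.MathematicalPhysics.QuantumFieldTheory
open Literature.Barriers.QuantumFields (uniformFlux fluxQuantum u1Plaquette u1Plaquette_uniformFlux)
open Summit.HubbardSuperconductivity.HubbardSuperconductivity.Theses.ChernVortexResponse

/-- **`MagneticTorusWellPosed`** (stmt-HubbardSuperconductivity-1194): for `L ≥ 3` the
one-flux-quantum magnetic Hubbard torus of the route is Hermitian, conserves `N` and `S^z`, and
its fluxless version is `hubbardTorus 2 L 1 U` — the tree's `magneticHubbardTorus_isHermitian`,
`magneticHubbardTorus_commute_totalNumber`, `magneticHubbardTorus_commute_spinZ` at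
`A = uniformFlux L` and `magneticHubbardTorus_one_eq_hubbardTorus` (`A = 1`, `L ≥ 3`), unfolded
by `magneticHubbardTorus_one`. Lieb, Phys. Rev. Lett. 73 (1994) 2158, eqs. (1)–(2). [folklore] -/
theorem magneticTorusWellPosed_proof :
    Summit.HubbardSuperconductivity.HubbardSuperconductivity.Theses.ChernVortexResponse.MagneticTorusWellPosed := by
  intro L _ hL U
  have h1 := magneticHubbardTorus_isHermitian (L := L) (uniformFlux L) 1 U
  have h2 := magneticHubbardTorus_commute_totalNumber (L := L) (uniformFlux L) 1 U
  have h3 := magneticHubbardTorus_commute_spinZ (L := L) (uniformFlux L) 1 U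
  have h4 := magneticHubbardTorus_one_eq_hubbardTorus (L := L) hL 1 U
  rw [magneticHubbardTorus_one] at h1 h2 h3 h4
  simp only [uniformFlux, fluxQuantum, Site.shift] at h1 h2 h3
  simp only [Site.shift, Pi.one_apply, Circle.coe_one, map_one, one_smul] at h4
  exact ⟨h1, h2, h3, h4⟩

/-- **`OneFluxQuantum`** (stmt-HubbardSuperconductivity-8615): for `L ≥ 2` the flux per
plaquette `2π/L²` lies in `(0, π)`, and every plaquette holonomy
`A(x,e₀) A(x+e₀,e₁) A(x+e₁,e₀)⁻¹ A(x,e₁)⁻¹` of the Landau-gauge field pinned by the route's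
defining equation equals `exp(2πi/L²)` (`u1Plaquette_uniformFlux`). Lüscher, Nucl. Phys. B 549
(1999) 295, §3 (3.3). [folklore] -/
theorem oneFluxQuantum_proof :
    Summit.HubbardSuperconductivity.HubbardSuperconductivity.Theses.ChernVortexResponse.OneFluxQuantum := by
  intro L _ hL
  have hL' : (2 : ℝ) ≤ (L : ℝ) := by exact_mod_cast hL
  have hL2 : (4 : ℝ) ≤ (L : ℝ) ^ 2 := by nlinarith
  refine ⟨⟨by positivity, ?_⟩, fun A hA x => ?_⟩
  · rw [div_lt_iff₀ (by positivity)]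
    nlinarith [Real.pi_pos]
  · have key := u1Plaquette_uniformFlux hL x
    have hAU : ∀ (y : Fin 2 → ZMod L) (i : Fin 2), A y i = uniformFlux L (y, i) := by
      intro y i
      rw [hA]
      simp only [uniformFlux, fluxQuantum]
    simp only [u1Plaquette, plaquetteHolonomy, Site.shift, fluxQuantum] at key
    rw [hAU, hAU, hAU, hAU]
    exact key

end Summit.HubbardSuperconductivity.HubbardSuperconductivity.Theorems.ChernVortexResponse
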